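import Summits.QuantumFields.YangMills.Theorems.AllWindowsColdBoxBulkMidSandwichLocalisedQCC

/-!
# The localised quadratic covariance comparison WITHOUT the centring hypothesis (recentred at the Gibbs mean)
# (crux idea `logconcave-core-extension` on ⟨stmt-QuantumFields-24006⟩ — consumer-ready form of the card's leaf
# «localised QCC at the intrinsic `r_K`»: the S7 assembly applies it to the surrogate `A_ω` as it comes, the
# recentring `x ↦ x − m_A` being done here once and for all)

`localisedQuadraticCovarianceComparison_uncentred`: same data as `localisedQuadraticCovarianceComparison` but NO
centring hypothesis; with the Gibbs mean `m_i = ∫x_i e^{−A}/∫e^{−A}` and the recentred linear coefficients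
`b'_f = b_f + 2H_f m`, `b'_g = b_g + 2H_g m`:

  `|gE(f·g) − gE(f)·gE(g) − rC'| ≤ 168·(δ_K + δ·p^{1/4})·√(rV'_f·rV'_g)`,

`rC' = 2tr(H₀⁻¹H_fH₀⁻¹H_g) + b'_fᵀH₀⁻¹b'_g`, `rV'` likewise, `p = ∫_{Kᶜ}e^{−A}/∫e^{−A}` (translation invariant).
PROOF: translate `A' := A(· + m)` (sandwich, smoothness and the core pinching on `K − m` transport; `A'` is centred
by the choice of `m`), covariances are invariant under the additive constants `f(y+m) − f'(y)`, Lebesgue measure is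
translation invariant (`integral_add_right_eq_self`).

HONEST SCOPE.  Free-hands work of the LEAD seat of ⟨stmt-QuantumFields-24006⟩ (FCL lineage) on an ingredient of an
UN-TRIAGED crux idea card; classical log-concave probability.  No stub of LINE-18, no crux, rung or summit is
proved; the Yang–Mills mass gap is NOT proved by any of this.
-/

noncomputable section

namespace Summit.QuantumFields.YangMills.Theorems.SandwichVariancePinching

open MeasureTheory Real Set
open scoped Matrix
open Summit.QuantumFields.YangMills.Cruxes.TransportCovarianceTransfer (dotProduct_mulVec_of_isSymm)

variable {n : ℕ}

/-- Second derivatives commute with translations: `D²(A(· + m))(y)(v,v) = D²A(y + m)(v,v)`. [folklore] -/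
theorem hess_translate (A : (Fin n → ℝ) → ℝ) (m y v : Fin n → ℝ) :
    fderiv ℝ (fderiv ℝ (fun z => A (z + m))) y v v = fderiv ℝ (fderiv ℝ A) (y + m) v v := by
  have h1 : fderiv ℝ (fun z => A (z + m)) = fun z => fderiv ℝ A (z + m) := by
    funext z; exact fderiv_comp_add_right m
  rw [h1, fderiv_comp_add_right]

/-- A quadratic observable at a translated point: `q_{H,b}(y + m) = q_{H, b + 2Hm}(y) + q_{H,b}(m)` (`H` symmetric).
[folklore] -/
theorem quadObs_translate {H : Matrix (Fin n) (Fin n) ℝ} (hH : H.IsSymm) (b m y : Fin n → ℝ) :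
    (y + m) ⬝ᵥ H *ᵥ (y + m) + b ⬝ᵥ (y + m) =
      (y ⬝ᵥ H *ᵥ y + (b + (2:ℝ) • H *ᵥ m) ⬝ᵥ y) + (m ⬝ᵥ H *ᵥ m + b ⬝ᵥ m) := by
  have e1 : y ⬝ᵥ H *ᵥ m = H *ᵥ m ⬝ᵥ y := by rw [dotProduct_mulVec_of_isSymm hH y m, dotProduct_comm, ← dotProduct_mulVec_of_isSymm hH m y, dotProduct_mulVec_of_isSymm hH m y]
  have e2 : m ⬝ᵥ H *ᵥ y = H *ᵥ m ⬝ᵥ y := dotProduct_mulVec_of_isSymm hH m y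
  simp only [Matrix.mulVec_add, dotProduct_add, add_dotProduct, smul_dotProduct, smul_eq_mul, e1, e2]
  ring

/-- **THE LOCALISED QUADRATIC COVARIANCE COMPARISON, UNCENTRED FORM** (see the module docstring). [folklore] -/
theorem localisedQuadraticCovarianceComparison_uncentred {H₀ : Matrix (Fin n) (Fin n) ℝ} (hH₀ : H₀.PosDef)
    {δ : ℝ} (hδ : 0 ≤ δ) (hδ2 : δ ≤ 1 / 2) {δK : ℝ} (hδK : 0 ≤ δK) (hδKδ : δK ≤ δ)
    (Hf Hg : Matrix (Fin n) (Fin n) ℝ) (bf bg : Fin n → ℝ) {A : (Fin n → ℝ) → ℝ}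
    (hHf : Hf.IsSymm) (hHg : Hg.IsSymm) (hA : ContDiff ℝ 2 A)
    (hsw : ∀ x h : Fin n → ℝ, (1 - δ) * (h ⬝ᵥ H₀ *ᵥ h) ≤ A (x + h) + A (x - h) - 2 * A x ∧
      A (x + h) + A (x - h) - 2 * A x ≤ (1 + δ) * (h ⬝ᵥ H₀ *ᵥ h))
    {K : Set (Fin n → ℝ)} (hK : MeasurableSet K)
    (hloc : ∀ x ∈ K, ∀ v : Fin n → ℝ, (1 - δK) * (v ⬝ᵥ H₀ *ᵥ v) ≤ fderiv ℝ (fderiv ℝ A) x v v ∧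
      fderiv ℝ (fderiv ℝ A) x v v ≤ (1 + δK) * (v ⬝ᵥ H₀ *ᵥ v)) :
    let m : Fin n → ℝ := fun i => (∫ x, x i * exp (-A x)) / ∫ x, exp (-A x)
    let bf' : Fin n → ℝ := bf + (2:ℝ) • Hf *ᵥ m
    let bg' : Fin n → ℝ := bg + (2:ℝ) • Hg *ᵥ m
    |(∫ x, (x ⬝ᵥ Hf *ᵥ x + bf ⬝ᵥ x) * (x ⬝ᵥ Hg *ᵥ x + bg ⬝ᵥ x) * exp (-A x)) / (∫ x, exp (-A x)) -
        (∫ x, (x ⬝ᵥ Hf *ᵥ x + bf ⬝ᵥ x) * exp (-A x)) / (∫ x, exp (-A x)) *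
          ((∫ x, (x ⬝ᵥ Hg *ᵥ x + bg ⬝ᵥ x) * exp (-A x)) / (∫ x, exp (-A x))) -
        (2 * (H₀⁻¹ * Hf * H₀⁻¹ * Hg).trace + bf' ⬝ᵥ H₀⁻¹ *ᵥ bg')| ≤
      168 * (δK + δ * Real.sqrt (Real.sqrt ((∫ x in Kᶜ, exp (-A x)) / ∫ x, exp (-A x)))) *
        Real.sqrt ((2 * (H₀⁻¹ * Hf * H₀⁻¹ * Hf).trace + bf' ⬝ᵥ H₀⁻¹ *ᵥ bf') *
          (2 * (H₀⁻¹ * Hg * H₀⁻¹ * Hg).trace + bg' ⬝ᵥ H₀⁻¹ *ᵥ bg')) := by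
  intro m bf' bg'
  have hδ1 : δ < 1 := by linarith
  obtain ⟨hZint, hZpos, hImom⟩ := sandwichMoments_of_lt_one δ hδ hδ1 n H₀ A hH₀ hA.continuous hsw
  set Z : ℝ := ∫ x, exp (-A x) with hZdef
  have hZne : Z ≠ 0 := hZpos.ne'
  -- the translated potential
  set A' : (Fin n → ℝ) → ℝ := fun y => A (y + m) with hA'
  have hA'2 : ContDiff ℝ 2 A' := hA.comp ((contDiff_id).add contDiff_const)
  have hsw' : ∀ y h : Fin n → ℝ, (1 - δ) * (h ⬝ᵥ H₀ *ᵥ h) ≤ A' (y + h) + A' (y - h) - 2 * A' y ∧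
      A' (y + h) + A' (y - h) - 2 * A' y ≤ (1 + δ) * (h ⬝ᵥ H₀ *ᵥ h) := by
    intro y h
    have e1 : A' (y + h) = A (y + m + h) := by simp only [hA']; congr 1; abel
    have e2 : A' (y - h) = A (y + m - h) := by simp only [hA']; congr 1; abel
    rw [e1, e2]
    exact hsw (y + m) h
  -- the translated core
  set K' : Set (Fin n → ℝ) := (fun y => y + m) ⁻¹' K with hK'
  have hK'm : MeasurableSet K' := hK.preimage (measurable_id.add_const m)
  have hloc' : ∀ y ∈ K', ∀ v : Fin n → ℝ, (1 - δK) * (v ⬝ᵥ H₀ *ᵥ v) ≤ fderiv ℝ (fderiv ℝ A') y v v ∧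
      fderiv ℝ (fderiv ℝ A') y v v ≤ (1 + δK) * (v ⬝ᵥ H₀ *ᵥ v) := by
    intro y hy v
    have e : fderiv ℝ (fderiv ℝ A') y v v = fderiv ℝ (fderiv ℝ A) (y + m) v v := hess_translate A m y v
    rw [e]; exact hloc (y + m) hy v
  -- translation invariance of the Gibbs integrals
  have htr : ∀ F : (Fin n → ℝ) → ℝ, ∫ y, F (y + m) * exp (-A' y) = ∫ x, F x * exp (-A x) := fun F =>
    integral_add_right_eq_self (μ := volume) (fun x => F x * exp (-A x)) m
  have hZ' : ∫ y, exp (-A' y) = Z := by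
    have h := integral_add_right_eq_self (μ := volume) (fun x => exp (-A x)) m
    simpa [hA'] using h
  have hP' : ∫ y in K'ᶜ, exp (-A' y) = ∫ x in Kᶜ, exp (-A x) := by
    rw [← integral_indicator hK'm.compl, ← integral_indicator hK.compl]
    have h := integral_add_right_eq_self (μ := volume) (fun x => Kᶜ.indicator (fun x => exp (-A x)) x) m
    -- `Kᶜ.indicator (e^{−A}) (y + m)` is definitionally `K'ᶜ.indicator (e^{−A'}) y`
    exact h
  -- `A'` is centred
  have hcent' : ∀ i : Fin n, ∫ y, y i * exp (-A' y) = 0 := by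
    intro i
    have hIi : Integrable fun x : Fin n → ℝ => x i * exp (-A x) := by
      have h := (hImom 0 0 (Pi.single i 1) 0).1
      refine h.congr (ae_of_all _ fun x => ?_)
      simp [Matrix.zero_mulVec]
    have h := htr (fun x => x i - m i)
    have e : (fun y : Fin n → ℝ => (fun x : Fin n → ℝ => x i - m i) (y + m) * exp (-A' y)) =
        fun y => y i * exp (-A' y) := by
      funext y; simp
    rw [e] at h
    rw [h]
    have e2 : (fun x : Fin n → ℝ => (x i - m i) * exp (-A x)) =
        fun x => x i * exp (-A x) - m i * exp (-A x) := by funext x; ring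
    rw [e2, integral_sub hIi (hZint.const_mul _), integral_const_mul]
    have hm : m i = (∫ x, x i * exp (-A x)) / Z := rfl
    rw [hm]; field_simp; ring
  -- the centred theorem for `A'`
  have key := localisedQuadraticCovarianceComparison hH₀ hδ hδ2 hδK hδKδ Hf Hg bf' bg' hHf hHg hA'2 hsw' hcent'
    hK'm hloc'
  rw [hZ', hP'] at key
  -- the three Gibbs integrals of `A'` in terms of those of `A`
  set cf : ℝ := m ⬝ᵥ Hf *ᵥ m + bf ⬝ᵥ m with hcf
  set cg : ℝ := m ⬝ᵥ Hg *ᵥ m + bg ⬝ᵥ m with hcg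
  set F : (Fin n → ℝ) → ℝ := fun x => x ⬝ᵥ Hf *ᵥ x + bf ⬝ᵥ x with hF
  set G : (Fin n → ℝ) → ℝ := fun x => x ⬝ᵥ Hg *ᵥ x + bg ⬝ᵥ x with hG
  have hF' : ∀ y, y ⬝ᵥ Hf *ᵥ y + bf' ⬝ᵥ y = F (y + m) - cf := fun y => by
    have := quadObs_translate hHf bf m y
    simp only [hF, hcf]; rw [this]; ring
  have hG' : ∀ y, y ⬝ᵥ Hg *ᵥ y + bg' ⬝ᵥ y = G (y + m) - cg := fun y => by
    have := quadObs_translate hHg bg m y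
    simp only [hG, hcg]; rw [this]; ring
  -- integrability (under `A`) of the pieces
  have iF : Integrable (fun x => F x * exp (-A x)) := (hImom Hf Hf bf bf).1
  have iG : Integrable (fun x => G x * exp (-A x)) := (hImom Hg Hg bg bg).1
  have iFG : Integrable (fun x => F x * G x * exp (-A x)) := (hImom Hf Hg bf bg).2
  set If : ℝ := ∫ x, F x * exp (-A x) with hIfdef
  set Ig : ℝ := ∫ x, G x * exp (-A x) with hIgdef
  set Ifg : ℝ := ∫ x, F x * G x * exp (-A x) with hIfgdef
  have h1 : ∫ y, (y ⬝ᵥ Hf *ᵥ y + bf' ⬝ᵥ y) * exp (-A' y) = If - cf * Z := by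
    simp only [hF']
    have h := htr (fun x => F x - cf)
    have e : (fun y => (fun x => F x - cf) (y + m) * exp (-A' y)) = fun y => (F (y + m) - cf) * exp (-A' y) := rfl
    rw [e] at h
    rw [h]
    have e2 : (fun x => (F x - cf) * exp (-A x)) = fun x => F x * exp (-A x) - cf * exp (-A x) := by
      funext x; ring
    rw [e2, integral_sub iF (hZint.const_mul _), integral_const_mul]
  have h2 : ∫ y, (y ⬝ᵥ Hg *ᵥ y + bg' ⬝ᵥ y) * exp (-A' y) = Ig - cg * Z := by
    simp only [hG']
    have h := htr (fun x => G x - cg)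
    have e : (fun y => (fun x => G x - cg) (y + m) * exp (-A' y)) = fun y => (G (y + m) - cg) * exp (-A' y) := rfl
    rw [e] at h
    rw [h]
    have e2 : (fun x => (G x - cg) * exp (-A x)) = fun x => G x * exp (-A x) - cg * exp (-A x) := by
      funext x; ring
    rw [e2, integral_sub iG (hZint.const_mul _), integral_const_mul]
  have h3 : ∫ y, (y ⬝ᵥ Hf *ᵥ y + bf' ⬝ᵥ y) * (y ⬝ᵥ Hg *ᵥ y + bg' ⬝ᵥ y) * exp (-A' y) =
      Ifg - cg * If - cf * Ig + cf * cg * Z := by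
    simp only [hF', hG']
    have h := htr (fun x => (F x - cf) * (G x - cg))
    have e : (fun y => (fun x => (F x - cf) * (G x - cg)) (y + m) * exp (-A' y)) =
        fun y => (F (y + m) - cf) * (G (y + m) - cg) * exp (-A' y) := rfl
    rw [e] at h
    rw [h]
    have e2 : (fun x => (F x - cf) * (G x - cg) * exp (-A x)) = fun x =>
        F x * G x * exp (-A x) - cg * (F x * exp (-A x)) - cf * (G x * exp (-A x)) + cf * cg * exp (-A x) := by
      funext x; ring
    have i1 : Integrable fun x => F x * G x * exp (-A x) - cg * (F x * exp (-A x)) := iFG.sub (iF.const_mul _)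
    have i2 : Integrable fun x => F x * G x * exp (-A x) - cg * (F x * exp (-A x)) - cf * (G x * exp (-A x)) :=
      i1.sub (iG.const_mul _)
    rw [e2, integral_add i2 (hZint.const_mul _), integral_sub i1 (iG.const_mul _),
      integral_sub iFG (iF.const_mul _), integral_const_mul, integral_const_mul, integral_const_mul]
  rw [h1, h2, h3] at key
  -- the covariance is invariant under the additive constants
  have hcov : (Ifg - cg * If - cf * Ig + cf * cg * Z) / Z - (If - cf * Z) / Z * ((Ig - cg * Z) / Z) =
      Ifg / Z - If / Z * (Ig / Z) := by
    field_simp; ring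
  rw [hcov] at key
  simpa only [hF, hG, hIfdef, hIgdef, hIfgdef, hZdef] using key

end Summit.QuantumFields.YangMills.Theorems.SandwichVariancePinching

end
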